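import Mathlib
import HarnessLib
import Summits.HubbardSuperconductivity.HubbardSuperconductivity.Theorems.WeakCouplingBCSWcbcsBcsConstructionDoubleCommutatorBound
import Literature.MathematicalPhysics.QuantumLattice.HubbardLSMFillingProofs
import Literature.Probability.LatticeModels.TorusFourierProofs

/-!
# Route `AposterioriCapRg` — crux `SsbToEvenTorusLro` (stmt-HubbardSuperconductivity-1315),
# line `pair-yrast-landau-floor`, stub `stub_doubleCommBound`

Graded-locality (Koma–Tasaki / Tasaki–Watanabe extensivity) bound on the double commutator
`[Δ_d(q)ᴴ, [K, Δ_d(q)]]` of the MOMENTUM-`q` `d`-wave pair field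
`A = pairFieldAt dWaveFormFactor L m = Σ_x conj χ_m(x) • P_x` with the grand-canonical torus Hubbard
Hamiltonian `K = hubbardTorusWith 2 L 1 U μ = H(1,U) - μN`:
`|Re⟨φ, (Aᴴ[K,A] - [K,A]Aᴴ) φ⟩| ≤ C (1 + |μ|) L² ⟨φ, φ⟩`, uniformly in the momentum label `m`.

Proof: the `q = 0` twin `dc_norm_doubleCommutator_le`
(`WeakCouplingBCSWcbcsBcsConstructionDoubleCommutatorBound.lean`) bounds `‖[O, [O, H]]‖` for ONE family
`O = Σ_y q_y` of even local observables; here the TWO-FAMILY version `dcq_norm_doubleCommutator_le`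
(outer family `q'_y`, inner family `q_y`, same supports, same norm bound) is proved line by line in
the same way: `[O', [O, H]] = Σ_x Σ_Z Σ_y [q'_y, [q_x, h_Z]]`, `[q_x, h_Z]` is even and localised on
`supp q_x ∪ supp h_Z`, so `[q'_y, ·]` kills it unless the supports meet (graded locality,
`commute_of_mem_carEvenSubalgebra`), and only `O(|κ|)` terms of `O(1)` norm survive. On the torus the
inner pieces are `q_y = conj χ_m(y) • P_y` (`pairFieldAt_eq_sum_torusChar`) and the outer ones
`q'_y = χ_m(y) • P_yᴴ` (`pairFieldAt_conjTranspose`); the phases have modulus one (`norm_torusChar`),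
so the supports and norm bounds are those of the `q = 0` case. The Rayleigh-quotient bound
`|Re⟨φ, Dφ⟩| ≤ ‖D‖ ⟨φ, φ⟩` (`abs_re_star_dotProduct_mulVec_le`) converts the operator-norm bound into
the registered quadratic-form inequality.
-/

namespace Summit.HubbardSuperconductivity.HubbardSuperconductivity.Theorems

set_option linter.dupNamespace false

open Literature.MathematicalPhysics.QuantumLattice Literature.Probability.LatticeModels Matrix
open scoped Matrix.Norms.L2Operator ComplexOrder ComplexConjugate

/-! ### Graded locality on a general finite graph: the two-family double commutator -/

section General

variable {Λ : Type*} [LinearOrder Λ] [Fintype Λ] (G : SimpleGraph Λ) [DecidableRel G.Adj]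

/-- **The two-family double-commutator bound, general form.** On a finite graph of maximal degree
`≤ Δ`, let `q_y` (`y : κ`) be EVEN observables localised on site sets `V y` of size `≤ s`, and `q'_y`
observables localised on the same sets, with `‖q_y‖, ‖q'_y‖ ≤ M`, such that every set `A` of sites
meets `V y` for at most `|A| · s` values of `y`. Then for `O = Σ_y q_y`, `O' = Σ_y q'_y` and
`H = H(t,U) - μN`,
`‖O' [O, H] - [O, H] O'‖ ≤ 4 |κ| s²(s+2)(2Δ+1) M² (2|t| + |U| + 2|μ|)`:
`[O',[O,H]] = Σ_x Σ_Z Σ_y [q'_y, [q_x, h_Z]]`, the `Z`-sum has `≤ s(2Δ+1)` non-zero terms of norm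
`≤ 2M ‖h_Z‖`, and for each of them the `y`-sum has `≤ (s+2)s` non-zero terms (graded locality,
Bratteli–Robinson II §5.2.2), each of norm `≤ 2M ‖[q_x, h_Z]‖`. Koma–Tasaki 1994, proof of
Theorem 2.2 (there with commuting `o_x`); the one-family case `q' = q` is
`dc_norm_doubleCommutator_le`. [cite: KomaTasaki1994, Theorem 2.2] -/
theorem dcq_norm_doubleCommutator_le {Δ s : ℕ}
    (hΔ : ∀ x : Λ, (Finset.univ.filter fun y => G.Adj x y).card ≤ Δ) (t U μ : ℝ)
    {κ : Type*} [Fintype κ] (V : κ → Finset Λ)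
    (q q' : κ → Matrix (Finset (Orb Λ)) (Finset (Orb Λ)) ℂ)
    (hq : ∀ y, q y ∈ carEvenSubalgebra (orbSet (V y)))
    (hq' : ∀ y, q' y ∈ carSubalgebra (orbSet (V y)))
    {M : ℝ} (hM0 : 0 ≤ M) (hM : ∀ y, ‖q y‖ ≤ M) (hM' : ∀ y, ‖q' y‖ ≤ M)
    (hV : ∀ y, (V y).card ≤ s)
    (hN : ∀ A : Finset Λ, (Finset.univ.filter fun y => ¬ Disjoint A (V y)).card ≤ A.card * s) :
    ‖(∑ y, q' y) * ((∑ y, q y) * hamiltonianWith G t U μ - hamiltonianWith G t U μ * ∑ y, q y) -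
        ((∑ y, q y) * hamiltonianWith G t U μ - hamiltonianWith G t U μ * ∑ y, q y) * ∑ y, q' y‖ ≤
      4 * Fintype.card κ * (s ^ 2 * (s + 2) * (2 * Δ + 1) : ℕ) * M ^ 2 * (2 * |t| + |U| + 2 * |μ|) := by
  -- adapted from `dc_norm_doubleCommutator_le` (the one-family case), outer family `q'`
  have hqs : ∀ y, q y ∈ carSubalgebra (orbSet (V y)) := fun y =>
    carEvenSubalgebra_le_carSubalgebra _ (hq y)
  -- Step 1: expand `[O', [O, H]] = Σ_x Σ_Z Σ_y [q'_y, [q_x, h_Z]]`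
  rw [← sum_hubbardTermOp G t U μ]
  have h1 : (∑ x, q x) * (∑ Z, hubbardTermOp G t U μ Z) - (∑ Z, hubbardTermOp G t U μ Z) * ∑ x, q x =
      ∑ x, ∑ Z, (q x * hubbardTermOp G t U μ Z - hubbardTermOp G t U μ Z * q x) := by
    rw [finset_sum_commutator]
    exact Finset.sum_congr rfl fun x _ => dc_commutator_finset_sum _ _ _
  have hexp : (∑ y, q' y) * (∑ x, ∑ Z, (q x * hubbardTermOp G t U μ Z - hubbardTermOp G t U μ Z * q x)) -
      (∑ x, ∑ Z, (q x * hubbardTermOp G t U μ Z - hubbardTermOp G t U μ Z * q x)) * ∑ y, q' y =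
      ∑ x, ∑ Z, ∑ y, (q' y * (q x * hubbardTermOp G t U μ Z - hubbardTermOp G t U μ Z * q x) -
        (q x * hubbardTermOp G t U μ Z - hubbardTermOp G t U μ Z * q x) * q' y) := by
    rw [dc_commutator_finset_sum]
    refine Finset.sum_congr rfl fun x _ => ?_
    rw [dc_commutator_finset_sum]
    refine Finset.sum_congr rfl fun Z _ => ?_
    exact finset_sum_commutator _ _ _
  rw [h1, hexp]
  -- Step 2: the `y`-sum, for fixed `x, Z` (graded locality of the OUTER family against `[q_x, h_Z]`)
  have hF : ∀ x Z, ∑ y, ‖q' y * (q x * hubbardTermOp G t U μ Z - hubbardTermOp G t U μ Z * q x) -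
      (q x * hubbardTermOp G t U μ Z - hubbardTermOp G t U μ Z * q x) * q' y‖ ≤
      ((s + 2) * s : ℕ) * (2 * M * ‖q x * hubbardTermOp G t U μ Z - hubbardTermOp G t U μ Z * q x‖) := by
    intro x Z
    have hc := dc_commutator_hubbardTermOp_mem_carEvenSubalgebra G t U μ (hq x) Z
    refine (dc_sum_norm_commutator_local_le V q' hq' hM' hc).trans ?_
    have hcard : (Finset.univ.filter fun y => ¬ Disjoint (V x ∪ hubbardTermSupp G Z) (V y)).card ≤
        (s + 2) * s := by
      refine (hN _).trans (Nat.mul_le_mul_right _ ?_)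
      exact (Finset.card_union_le _ _).trans (add_le_add (hV x) (dc_card_hubbardTermSupp_le_two G Z))
    have hnn : 0 ≤ 2 * M * ‖q x * hubbardTermOp G t U μ Z - hubbardTermOp G t U μ Z * q x‖ := by
      positivity
    exact mul_le_mul_of_nonneg_right (by exact_mod_cast hcard) hnn
  -- Step 3: the `Z`-sum, for fixed `x` (graded locality of the INNER family against the `h_Z`)
  have hZsum : ∀ x, ∑ Z, ‖q x * hubbardTermOp G t U μ Z - hubbardTermOp G t U μ Z * q x‖ ≤
      (s * (2 * Δ + 1) : ℕ) * (2 * (2 * |t| + |U| + 2 * |μ|) * M) := by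
    intro x
    refine (dc_sum_norm_commutator_hubbardTermOp_le G hΔ t U μ (hqs x)).trans ?_
    have h1 : (((V x).card * (2 * Δ + 1) : ℕ) : ℝ) ≤ ((s * (2 * Δ + 1) : ℕ) : ℝ) := by
      exact_mod_cast Nat.mul_le_mul_right _ (hV x)
    calc (((V x).card * (2 * Δ + 1) : ℕ) : ℝ) * (2 * (2 * |t| + |U| + 2 * |μ|) * ‖q x‖)
        ≤ ((s * (2 * Δ + 1) : ℕ) : ℝ) * (2 * (2 * |t| + |U| + 2 * |μ|) * ‖q x‖) :=
          mul_le_mul_of_nonneg_right h1 (by positivity)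
      _ ≤ ((s * (2 * Δ + 1) : ℕ) : ℝ) * (2 * (2 * |t| + |U| + 2 * |μ|) * M) := by
          gcongr
          exact hM x
  -- Step 4: assemble
  calc ‖∑ x, ∑ Z, ∑ y, (q' y * (q x * hubbardTermOp G t U μ Z - hubbardTermOp G t U μ Z * q x) -
          (q x * hubbardTermOp G t U μ Z - hubbardTermOp G t U μ Z * q x) * q' y)‖
      ≤ ∑ x, ‖∑ Z, ∑ y, (q' y * (q x * hubbardTermOp G t U μ Z - hubbardTermOp G t U μ Z * q x) -
          (q x * hubbardTermOp G t U μ Z - hubbardTermOp G t U μ Z * q x) * q' y)‖ := norm_sum_le _ _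
    _ ≤ ∑ x, ∑ Z, ‖∑ y, (q' y * (q x * hubbardTermOp G t U μ Z - hubbardTermOp G t U μ Z * q x) -
          (q x * hubbardTermOp G t U μ Z - hubbardTermOp G t U μ Z * q x) * q' y)‖ :=
        Finset.sum_le_sum fun x _ => norm_sum_le _ _
    _ ≤ ∑ x, ∑ Z, ∑ y, ‖q' y * (q x * hubbardTermOp G t U μ Z - hubbardTermOp G t U μ Z * q x) -
          (q x * hubbardTermOp G t U μ Z - hubbardTermOp G t U μ Z * q x) * q' y‖ :=
        Finset.sum_le_sum fun x _ => Finset.sum_le_sum fun Z _ => norm_sum_le _ _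
    _ ≤ ∑ x, ∑ Z, ((s + 2) * s : ℕ) *
          (2 * M * ‖q x * hubbardTermOp G t U μ Z - hubbardTermOp G t U μ Z * q x‖) :=
        Finset.sum_le_sum fun x _ => Finset.sum_le_sum fun Z _ => hF x Z
    _ = ((s + 2) * s : ℕ) * (2 * M) *
          ∑ x, ∑ Z, ‖q x * hubbardTermOp G t U μ Z - hubbardTermOp G t U μ Z * q x‖ := by
        rw [Finset.mul_sum]
        refine Finset.sum_congr rfl fun x _ => ?_
        rw [Finset.mul_sum]
        refine Finset.sum_congr rfl fun Z _ => ?_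
        ring
    _ ≤ ((s + 2) * s : ℕ) * (2 * M) *
          ∑ _x : κ, ((s * (2 * Δ + 1) : ℕ) : ℝ) * (2 * (2 * |t| + |U| + 2 * |μ|) * M) := by
        gcongr with x _
        exact hZsum x
    _ = 4 * Fintype.card κ * (s ^ 2 * (s + 2) * (2 * Δ + 1) : ℕ) * M ^ 2 * (2 * |t| + |U| + 2 * |μ|) := by
        rw [Finset.sum_const, Finset.card_univ, nsmul_eq_mul]
        push_cast
        ring

end General

/-! ### Specialisation to the momentum-`q` pair field on the torus -/

section Torus

variable (g : Site 2 → ℝ) (L : ℕ) [NeZero L]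

/-- **The double-commutator bound for the momentum-`q` pair field on the torus**, for every form
factor `g`, hopping `t`, coupling `U`, chemical potential `μ` and momentum label `m`: with
`A = Δ_g(m) = Σ_x conj χ_m(x) P_x`, `H = H(t,U) - μN` on `(ℤ/Lℤ)²`, `s = #{0, ±e₁, ±e₂}` and
`K = 2 Σ_e |g e/√2|`,
`‖Aᴴ [A, H] - [A, H] Aᴴ‖ ≤ 36 s²(s+2) K² (2|t| + |U| + 2|μ|) L²` — the two-family bound
`dcq_norm_doubleCommutator_le` with inner pieces `conj χ_m(y) • P_y` and outer pieces `χ_m(y) • P_yᴴ`,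
both localised on the `≤ 5` sites `y + e` and of norm `≤ K` (`‖χ_m(y)‖ = 1`). As in the `q = 0` twin
`dc_norm_doubleCommutator_pairField_le`, the statement is made for an ARBITRARY
`DecidableEq (FermionTorus 2 L)` instance (on which the `L²`-operator norm depends syntactically) and
the proof substitutes `LinearOrder.toDecidableEq`. [cite: KomaTasaki1994, Theorem 2.2] -/
theorem dcq_norm_doubleCommutator_pairFieldAt_le (t U μ : ℝ) (m : TorusSite 2 L)
    [inst : DecidableEq (FermionTorus 2 L)] :
    ‖(pairFieldAt g L m)ᴴ *
          (pairFieldAt g L m * hubbardTorusWith 2 L t U μ - hubbardTorusWith 2 L t U μ * pairFieldAt g L m) -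
        (pairFieldAt g L m * hubbardTorusWith 2 L t U μ - hubbardTorusWith 2 L t U μ * pairFieldAt g L m) *
          (pairFieldAt g L m)ᴴ‖ ≤
      36 * ((insert (0 : Site 2) unitSteps).card : ℝ) ^ 2 * ((insert (0 : Site 2) unitSteps).card + 2) *
        (2 * ∑ e ∈ insert (0 : Site 2) unitSteps, |g e / Real.sqrt 2|) ^ 2 *
        (2 * |t| + |U| + 2 * |μ|) * (L : ℝ) ^ 2 := by
  -- adapted from `dc_norm_doubleCommutator_pairField_le` (the `q = 0` case)
  have hinst : inst = LinearOrder.toDecidableEq := Subsingleton.elim _ _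
  subst hinst
  letI hdec : DecidableEq (FermionTorus 2 L) := LinearOrder.toDecidableEq
  set S : Finset (Site 2) := insert 0 unitSteps with hS_def
  set K : ℝ := 2 * ∑ e ∈ S, |g e / Real.sqrt 2| with hK_def
  -- the local pieces `q_y = conj χ_m(y) • P_y` of `Δ_g(m)`, `q'_y = χ_m(y) • P_yᴴ` of `Δ_g(m)ᴴ`,
  -- and their common supports
  set q : TorusSite 2 L → Matrix (Finset (Orb (FermionTorus 2 L))) (Finset (Orb (FermionTorus 2 L))) ℂ :=
    fun y => conj (torusChar m y) • localPair g L y with hq_def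
  set q' : TorusSite 2 L → Matrix (Finset (Orb (FermionTorus 2 L))) (Finset (Orb (FermionTorus 2 L))) ℂ :=
    fun y => torusChar m y • (localPair g L y)ᴴ with hq'_def
  set V : TorusSite 2 L → Finset (FermionTorus 2 L) :=
    fun y => S.image fun e => FermionTorus.ofTorusSite (y + Torus.proj L e) with hV_def
  have hyV : ∀ y, FermionTorus.ofTorusSite y ∈ V y := fun y => by
    have h0 : Torus.proj L (0 : Site 2) = 0 := funext fun i => by simp
    exact Finset.mem_image.2 ⟨0, Finset.mem_insert_self _ _, by rw [h0, add_zero]⟩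
  have heV : ∀ y, ∀ e ∈ S, FermionTorus.ofTorusSite (y + Torus.proj L e) ∈ V y := fun y e he =>
    Finset.mem_image_of_mem _ he
  have hq : ∀ y, q y ∈ carEvenSubalgebra (orbSet (V y)) := fun y => by
    simp only [hq_def]
    rw [Literature.Barriers.HubbardSuperconductivity.localPair_eq_sum_bondPair]
    exact Subalgebra.smul_mem _ (Subalgebra.sum_mem _ fun e he =>
      Subalgebra.smul_mem _ (dc_bondPair_mem_carEvenSubalgebra (hyV y) (heV y e he)) _) _
  have hq' : ∀ y, q' y ∈ carSubalgebra (orbSet (V y)) := fun y => by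
    refine carEvenSubalgebra_le_carSubalgebra _ ?_
    simp only [hq'_def]
    rw [Literature.Barriers.HubbardSuperconductivity.localPair_eq_sum_bondPair, conjTranspose_sum]
    refine Subalgebra.smul_mem _ (Subalgebra.sum_mem _ fun e he => ?_) _
    rw [conjTranspose_smul]
    exact Subalgebra.smul_mem _
      (dc_bondPair_conjTranspose_mem_carEvenSubalgebra (hyV y) (heV y e he)) _
  have hM : ∀ y, ‖q y‖ ≤ K := fun y => by
    simp only [hq_def]
    rw [norm_smul, Complex.norm_conj, norm_torusChar, one_mul]
    exact norm_localPair_le g L y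
  have hM' : ∀ y, ‖q' y‖ ≤ K := fun y => by
    simp only [hq'_def]
    rw [norm_smul, norm_torusChar, one_mul, l2_opNorm_conjTranspose]
    exact norm_localPair_le g L y
  have hV : ∀ y, (V y).card ≤ S.card := fun y => Finset.card_image_le
  have hA' : (pairFieldAt g L m)ᴴ = ∑ y, q' y := pairFieldAt_conjTranspose g L m
  have hA : pairFieldAt g L m = ∑ y, q y := pairFieldAt_eq_sum_torusChar g L m
  have key := dcq_norm_doubleCommutator_le (fermionTorusGraph 2 L) (Δ := 4) (s := S.card)
    (fun x => SourceGas.card_filter_fermionTorusGraph_adj_le x) t U μ V q q' hq hq' (M := K)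
    (by positivity) hM hM' hV ?_
  · rw [hA', hA, hubbardTorusWith]
    refine key.trans (le_of_eq ?_)
    rw [card_torusSite_two]
    push_cast
    ring
  · -- counting: `A` meets `V y` only for `y = w - e`, `w ∈ A`, `e ∈ S`
    -- (the subset is taken from the goal, whose decidability instances are the generic ones)
    intro A
    refine (Finset.card_le_card (t := A.biUnion fun w => S.image fun e =>
      FermionTorus.toTorusSite w - Torus.proj L e) fun y hy => ?_).trans ?_
    · rw [Finset.mem_filter] at hy
      obtain ⟨w, hwA, hwV⟩ := Finset.not_disjoint_iff.1 hy.2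
      obtain ⟨e, he, hwe⟩ := Finset.mem_image.1 hwV
      refine Finset.mem_biUnion.2 ⟨w, hwA, Finset.mem_image.2 ⟨e, he, ?_⟩⟩
      rw [← hwe, FermionTorus.toTorusSite_ofTorusSite, add_sub_cancel_right]
    · calc (A.biUnion fun w => S.image fun e => FermionTorus.toTorusSite w - Torus.proj L e).card
          ≤ ∑ w ∈ A, (S.image fun e => FermionTorus.toTorusSite w - Torus.proj L e).card :=
            Finset.card_biUnion_le
        _ ≤ ∑ _w ∈ A, S.card := Finset.sum_le_sum fun w _ => Finset.card_image_le
        _ = A.card * S.card := by rw [Finset.sum_const, smul_eq_mul]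

end Torus

/-! ### The stub -/

/-- **Stub (B) `stub_doubleCommBound`** of the line `pair-yrast-landau-floor` (crux `SsbToEvenTorusLro`):
graded-locality (Tasaki–Watanabe extensivity) bound on the double commutator of the momentum-`q`
`d`-wave pair field `A = Δ_d(q)` with the grand-canonical torus Hamiltonian `K = H(1,U) - μN̂`:
`|Re⟨φ, (Aᴴ[K,A] - [K,A]Aᴴ) φ⟩| ≤ C (1+|μ|) L² ⟨φ, φ⟩` for `U > 0`, uniformly in the momentum label,
with `C = 36 s²(s+2) K² (2 + U)`, `s = #{0, ±e₁, ±e₂}`, `K = 2 Σ_e |d(e)/√2|` — `[K, P_y]` is even and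
supported within one step of `supp P_y`, and `[P_xᴴ, ·]` kills it unless the supports meet, so
`O(L²)` terms of `O(1)` norm survive (`dcq_norm_doubleCommutator_pairFieldAt_le`); the operator-norm
bound is turned into the quadratic-form bound by `|Re⟨φ, Dφ⟩| ≤ ‖D‖ ⟨φ, φ⟩` and
`2 + |U| + 2|μ| ≤ (2 + U)(1 + |μ|)`. Koma–Tasaki 1994, proof of Theorem 2.2 (with the norm count
replacing `[o_x, o_y] = 0`). [cite: KomaTasaki1994, Theorem 2.2] -/
theorem stub_doubleCommBound :
    ∀ U : ℝ, 0 < U → ∃ C : ℝ, 0 ≤ C ∧ ∀ (L : ℕ) [NeZero L] (μ : ℝ) (m : TorusSite 2 L) (φ : Fock (Orb (FermionTorus 2 L))), |(star φ ⬝ᵥ (((pairFieldAt dWaveFormFactor L m)ᴴ * (hubbardTorusWith 2 L 1 U μ * pairFieldAt dWaveFormFactor L m - pairFieldAt dWaveFormFactor L m * hubbardTorusWith 2 L 1 U μ) - (hubbardTorusWith 2 L 1 U μ * pairFieldAt dWaveFormFactor L m - pairFieldAt dWaveFormFactor L m * hubbardTorusWith 2 L 1 U μ) * (pairFieldAt dWaveFormFactor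 L m)ᴴ) *ᵥ φ)).re| ≤ C * (1 + |μ|) * (L : ℝ) ^ 2 * (star φ ⬝ᵥ φ).re := by
  intro U hU
  set s : ℕ := (insert (0 : Site 2) unitSteps).card with hs_def
  set K : ℝ := 2 * ∑ e ∈ insert (0 : Site 2) unitSteps, |dWaveFormFactor e / Real.sqrt 2| with hK_def
  refine ⟨36 * (s : ℝ) ^ 2 * (s + 2) * K ^ 2 * (2 + U), by positivity, fun L _ μ m φ => ?_⟩
  set A := pairFieldAt dWaveFormFactor L m with hA_def
  set H := hubbardTorusWith 2 L 1 U μ with hH_def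
  -- the registered orientation `Aᴴ[H,A] - [H,A]Aᴴ` is minus the twin's `Aᴴ[A,H] - [A,H]Aᴴ`
  have hflip : Aᴴ * (H * A - A * H) - (H * A - A * H) * Aᴴ =
      -(Aᴴ * (A * H - H * A) - (A * H - H * A) * Aᴴ) := by
    rw [← neg_sub (A * H) (H * A), mul_neg, neg_mul, neg_sub_neg, neg_sub]
  have hnorm : ‖Aᴴ * (H * A - A * H) - (H * A - A * H) * Aᴴ‖ ≤
      36 * (s : ℝ) ^ 2 * (s + 2) * K ^ 2 * (2 * |(1 : ℝ)| + |U| + 2 * |μ|) * (L : ℝ) ^ 2 := by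
    rw [hflip, norm_neg]
    exact dcq_norm_doubleCommutator_pairFieldAt_le dWaveFormFactor L 1 U μ m
  have hray := abs_re_star_dotProduct_mulVec_le (Aᴴ * (H * A - A * H) - (H * A - A * H) * Aᴴ) φ
  have hφ : 0 ≤ (star φ ⬝ᵥ φ).re := (Complex.nonneg_iff.1 (dotProduct_star_self_nonneg φ)).1
  have hJ : 2 * |(1 : ℝ)| + |U| + 2 * |μ| ≤ (2 + U) * (1 + |μ|) := by
    rw [abs_one, abs_of_pos hU]
    nlinarith [abs_nonneg μ, hU.le]
  calc |(star φ ⬝ᵥ ((Aᴴ * (H * A - A * H) - (H * A - A * H) * Aᴴ) *ᵥ φ)).re|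
      ≤ ‖Aᴴ * (H * A - A * H) - (H * A - A * H) * Aᴴ‖ * (star φ ⬝ᵥ φ).re := hray
    _ ≤ 36 * (s : ℝ) ^ 2 * (s + 2) * K ^ 2 * (2 * |(1 : ℝ)| + |U| + 2 * |μ|) * (L : ℝ) ^ 2 *
          (star φ ⬝ᵥ φ).re := mul_le_mul_of_nonneg_right hnorm hφ
    _ ≤ 36 * (s : ℝ) ^ 2 * (s + 2) * K ^ 2 * ((2 + U) * (1 + |μ|)) * (L : ℝ) ^ 2 *
          (star φ ⬝ᵥ φ).re := by
        refine mul_le_mul_of_nonneg_right ?_ hφ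
        refine mul_le_mul_of_nonneg_right ?_ (by positivity)
        exact mul_le_mul_of_nonneg_left hJ (by positivity)
    _ = 36 * (s : ℝ) ^ 2 * (s + 2) * K ^ 2 * (2 + U) * (1 + |μ|) * (L : ℝ) ^ 2 *
          (star φ ⬝ᵥ φ).re := by ring

end Summit.HubbardSuperconductivity.HubbardSuperconductivity.Theorems
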